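import Literature.NumberTheory.Kottwitz1986BaseChangeUnits.UnitBaseChange
import HarnessLib

/-!
# Kottwitz (1986), *Base change for unit elements of Hecke algebras* — the POSITED analytic sockets
# (orbital integrals as functionals, signs, stable classes, `κ`, Arthur's weight), the printed
# definitions they obey (SO_γ, SO_{δθ}, «matching orbital integrals»), PROPOSITION 1 (p. 245) and the
# §3 PROPOSITION (p. 248), AS A TYPED DICTIONARY (statements only) — ED. 2

Source: R. E. Kottwitz, *Base change for unit elements of Hecke algebras*, Compositio Math. **60**
(1986) 237–250 (bib `Kottwitz1986BaseChangeUnits`).  Open copy of record: NUMDAM item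
`CM_1986__60_2_237_0` (lit store key `paper:url-52c464c05c51`; PDF page `n` = printed page
`235 + n`); formulas read off the decoded page scans
`run/shared/lean/pub/hodgecm-mathlib/T/KOT/TK-t12/g0/Kottwitz1986BaseChangeUnits-NUMDAM/img/pNNNN.png`
(= printed page `NNN`); page pins `(p. N)` are PRINTED pages.  Companion of `UnitBaseChange.lean`
(same directory; imported: the subgroup-level vocabulary `ptsF`/`ptsE`/`fixX`/`fixXE`/`unitF`/`unitE`,
the correspondence `SatisfiesAB`/`Corresponds` = ★ `MainResult.CondAB`/`Corr`) and of ★ `MainResult.lean`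
(TK-t08, p848072), which OWNS §1 «Main result» pp. 239–244.  Carpet-typing squad TK (cell
`pub/hodgecm-mathlib`, GO 500, seat TK-t12).  STATEMENTS ONLY: **no theorem, no proof, no `sorry`, no
axiom, no instance, no notation**; nothing is asserted.

**ED. 2 (consolidation, TK-plan rulings 2026-09-02T02:37:28Z / 02:39:50Z).**  ED. 1 (p848174) also
typed, over the sockets below, the THEOREM (p. 243), the technical point on signs (p. 243), the
COROLLARY and its supplement (p. 244) as `Kottwitz1986BaseChangeUnits_1_theorem`, `_1_signs_eq`,
`_1_corollary`, `_1_corollary_supplement`.  Those four rows restate ★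
`MainResult.OrbitalDatum.Theorem`, `.signs_equal`, `.Corollary`, `.Supplement` (same printed
statements over TK-t08's unit-only sockets `orbF`, `orbE`, `stOrbF`, `stOrbE`, `eF`, `eE`,
`IsStableNormOf`) and are **DROPPED here — THEOREM / COROLLARY: see ★ `MainResult` (TK-t08)**.  Socket
dictionary (parallel posits within one source, squad rule V3): `O (unitF σ KL) γ` ↔ `orbF γ`,
`TO (unitE σ l KL) δ` ↔ `orbE δ`, `SO (unitF σ KL)` ↔ `stOrbF`, `STO (unitE σ l KL)` ↔ `stOrbE`,
`sign` ↔ `eF`, `signTw` ↔ `eE`, `IsStableNorm δ γ` ↔ `IsStableNormOf γ δ`; what this file's sockets add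
is that `O`, `TO`, `SO`, `STO`, `WO`, `WTO` are FUNCTIONALS of the test function (the printed
generality of «matching orbital integrals», p. 239, and of §3), plus the `κ`-objects of §2 and the
weight of §3, which MainResult does not posit.

## The print (pp. 238–239, 243–245, 247–249)

p. 238: «Let `dg` (resp. `dg_E`) be the Haar measure on `G(F)` (resp. `G(E)`) that gives `K` (resp.
`K_E`) measure 1.  For `γ ∈ G(F)` and `f ∈ C_c^∞(G(F))` we denote by `O_γ(f)` the orbital integral
`∫_{G_γ(F)\G(F)} f(g⁻¹γg) dg/dt`.  This requires a choice of Haar measure `dt` on `G_γ(F)`» …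
«For `δ ∈ G(E)` and `f ∈ C_c^∞(G(E))` we have the twisted orbital integral `O_{δθ}(f)`, given by
`∫_{I_{δθ}(F)\G(E)} f(g⁻¹δθ(g)) dg_E/du`, where `I_{δθ}` denotes the fixed points of `Int(δ) ∘ θ`
on `I`.» «For semisimple `γ ∈ G(F)` we have the stable orbital integral `SO_γ`, given as a linear
form on `C_c^∞(G(F))` by `SO_γ = Σ_{γ′} e(G_{γ′}) O_{γ′}`, where the sum is taken over a set of
representatives `γ′` for the conjugacy classes within the stable conjugacy class of `γ`, and where
`e(G_{γ′}) = ±1` is the sign [K3] attached to the connected reductive `F`-group `G_{γ′}`.» «For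
`δ ∈ G(E)` such that `Nδ` is semisimple we have the "stable" twisted orbital integral
`SO_{δθ} = Σ_{δ′} e(I_{δ′θ}) O_{δ′θ}`, where the sum is taken over a set of representatives `δ′` for
the twisted conjugacy classes within the stable twisted conjugacy class of `δ`» (pp. 238–239).
p. 239: «As usual we say that `f_E`, `f` have matching orbital integrals if for every semisimple
`γ ∈ G(F)` the stable orbital integral `SO_γ(f)` vanishes unless the stable conjugacy class of `γ` is
equal to `𝒩δ` for some `δ ∈ G(E)`, in which case it is given by `SO_γ(f) = SO_{δθ}(f_E)`.  Of course
we are using compatible Haar measures on `G_γ(F)`, `I_{δθ}(F)`».  p. 243 THEOREM, p. 244 COROLLARY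
(+ supplement), p. 245 PROPOSITION 1, p. 248 PROPOSITION — quoted in the docstrings below.

## What is typed, and how

* §1 — **`UnitOrbitalData`**, the POSITED analytic sockets (V1 style of the squad) attached to the
  concrete setting of `UnitBaseChange.lean`: semisimple / regular semisimple elements, the
  functionals `O_γ(φ)`, `O_{δθ}(φ)`, `SO_γ(φ)`, `SO_{δθ}(φ)`, the signs `e(G_γ)`, `e(I_{δθ})`, stable
  (twisted) conjugacy, «the stable conjugacy class of `γ` is `𝒩δ`», compatibility of the Haar
  measures on `G_γ(F)`, `I_{δθ}(F)` under `g ↦ cgc⁻¹`, the characters `κ` of `H¹(F, I_{δθ})` with the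
  `κ`-orbital integrals, and for §3 the Levi `M(L)`, Arthur's weight `v_M`, `WO_γ(φ)`, `WO_{δθ}(φ)`.
  Nothing is asserted by the structure; the printed definitions/conventions are separate law
  predicates (`SOLaw`, `STOLaw`, `NonvanishingLaw`, `WeightLaw`) a consumer takes as hypotheses.
* §2 — the printed statements over the datum that ★ MainResult does not carry: PROPOSITION 1
  (p. 245), §3 PROPOSITION (p. 248) and «enough `γ, δ` … for `M`» (p. 249).  (THEOREM p. 243 =
  ★ `MainResult.OrbitalDatum.Theorem`, whose fixed-point clauses are its `orb_ne_zero_iff` +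
  `fixedCoset_transport`; signs p. 243 = `.signs_equal`; COROLLARY + supplement p. 244 = `.Corollary`,
  `.Supplement`.)

NOT typed (said here, not hidden): the Hecke algebras `ℋ`, `ℋ_E` and the base change homomorphism
`b` with its Satake characterisation (p. 237) — the statements only use `b(1_{K_E}) = 1_K` (p. 239),
which is how `unitF`/`unitE` enter; the discrete formulas `O_{δθ}(f_E) = Σ_x meas(I_{δθ}(F)_x)⁻¹`,
`O_γ(f) = Σ_x meas(G_γ(F)_x)⁻¹` (pp. 240–241) and `WO_γ(f) = Σ_x meas(G_γ(F)_x)⁻¹ w_M(x)` (p. 248)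
(proof internals); the inner twisting `β` and the scheme `Isom_A(I_{δθ}, G_γ)` (p. 243); the
invariant `inv(δ, δ′) ∈ H¹(F, I_{δθ})` and the injection `H¹(F, T) → B(T)` of [K4] (pp. 244–245)
beyond the opaque character type `Kappa`; the real vector space `𝔞_M = Hom_ℤ(Hom_F(M, 𝔾_m), ℝ)`,
`H_M`, `H_P`, `v_P(λ, g) = e^{-λ(H_P(g))}` and the `(G, M)`-family of [A] producing `v_M` (pp. 247–248;
no tree vocabulary for `(G, M)`-families) — only `v_M` with its two printed invariances is posited.
DEDUP: as in `UnitBaseChange.lean` (the three Arthur-2013-audit readers of this paper; the tree's ★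
`Automorphic.orbitalIntegral` / ★ `FixedPointCount.twistedOrbitalIntegral` take the quotient measure
as a parameter, while the paper's normalisation `dg/dt` with `K` of measure 1 and `dt` transported
along `g ↦ cgc⁻¹` is exactly what is not constructible here — hence posited functionals, with the
dictionary recorded field by field).  Other tree letters of the SAME printed object
`SO_γ = Σ_{γ′} e(G_{γ′}) O_{γ′}` (T-ref5 QA-10 NB-1; one dictionary, three settings): ★
`Kottwitz1986.LocalConjectures.LocalConjecturesData.SO` (Kottwitz, Math. Ann. 275, 5.2, over that file's
datum tower), ★ `Morel2010Shimura.Ch5GeometricSideStableTF.signedStableOrbitalIntegral` (generic group,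
over ★ `classOrbitalIntegral`), and `UnitOrbitalData.SO` + `SOLaw` here (abstract `G(L) ⊃ G(F)` sockets).

HONEST LABEL: HC_CM is proved only modulo the 7 printed citations (2 remaining: hLiu418 =
stmt-HodgeConjecture-24832, h413 = stmt-HodgeConjecture-24833) until rung 0 closes.
-/

namespace Literature.NumberTheory.Kottwitz1986BaseChangeUnits.UnitOrbitalIntegrals

open Literature.NumberTheory.Kottwitz1986BaseChangeUnits.UnitBaseChange

universe u

/-! ## §1 The datum: posited analytic sockets (orbital integrals, signs, stable classes, `κ`, weights) -/

/-- **`UnitOrbitalData G σ l j KL`** — the POSITED analytic objects of the paper attached to the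
concrete setting of §1 (`G(L)` (the Lean type `G`) with Frobenius `σ`, `l = [E : F]`, `θ = σ^j|_E`, `K_L = KL`):
semisimplicity, the orbital integrals `O_γ(φ)` (p. 238, `dg` giving `K` measure 1, a chosen `dt` on
each `G_γ(F)`), `O_{δθ}(φ)` (p. 238, `dg_E` giving `K_E` measure 1, `du` on `I_{δθ}(F)`), the stable
versions `SO_γ`, `SO_{δθ}` (pp. 238–239), Kottwitz's signs `e(G_γ)`, `e(I_{δθ})` [K3], stable
(`θ`-)conjugacy, the stable norm `𝒩`, compatibility of the measures `dt`, `du` under `g ↦ cgc⁻¹`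
(p. 241), the characters `κ` of `H¹(F, I_{δθ})` with the `κ`-orbital integrals `O^κ_{δθ}`, `O^κ_γ`
(pp. 244–245), and for §3 the Levi subgroup `M` over `𝔬` (through `M(L)`), Arthur's weight `v_M` on
`G(L)` and the (twisted) weighted orbital integrals `WO_γ(φ)`, `WO_{δθ}(φ)` (p. 248).  Functions are
`φ : G → ℂ` (test functions on `G(F)` resp. `G(E)`, extended by junk).  NOTHING is asserted by the
structure; the printed conventions are the law predicates below.
[cite: Kottwitz1986BaseChangeUnits, Introduction pp. 237–239; §2 pp. 244–245; §3 pp. 247–248] -/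
structure UnitOrbitalData (G : Type u) [Group G] (σ : MulAut G) (l j : ℕ) (KL : Subgroup G) :
    Type (u + 1) where
  /-- `γ` is semisimple («For semisimple `γ ∈ G(F)`», p. 238; also used for `Nδ`, p. 238) -/
  IsSemisimple : G → Prop
  /-- `γ` is regular semisimple («`Nδ` is regular and semisimple.  Then `I_{δθ}` is a torus», p. 244) -/
  IsRegular : G → Prop
  /-- `O φ γ = O_γ(φ) = ∫_{G_γ(F)\G(F)} φ(g⁻¹γg) dg/dt` [p. 238] -/
  O : (G → ℂ) → G → ℂ
  /-- `TO φ δ = O_{δθ}(φ) = ∫_{I_{δθ}(F)\G(E)} φ(g⁻¹δθ(g)) dg_E/du` [p. 238] -/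
  TO : (G → ℂ) → G → ℂ
  /-- `SO φ γ = SO_γ(φ) = Σ_{γ′} e(G_{γ′}) O_{γ′}(φ)` [p. 238] -/
  SO : (G → ℂ) → G → ℂ
  /-- `STO φ δ = SO_{δθ}(φ) = Σ_{δ′} e(I_{δ′θ}) O_{δ′θ}(φ)` [pp. 238–239] -/
  STO : (G → ℂ) → G → ℂ
  /-- `sign γ = e(G_γ) = ±1`, «the sign [K3] attached to the connected reductive `F`-group `G_{γ′}`» [p. 238] -/
  sign : G → ℤˣ
  /-- `signTw δ = e(I_{δθ})` [pp. 239, 243] -/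
  signTw : G → ℤˣ
  /-- `IsStConj γ γ′`: `γ, γ′ ∈ G(F)` are stably conjugate («stable conjugacy is the same as
  `G(F̄)`-conjugacy», p. 238) -/
  IsStConj : G → G → Prop
  /-- `IsStTwConj δ δ′`: «the stable twisted conjugacy class of `δ`» = the fibre of `𝒩` through `δ` [p. 238] -/
  IsStTwConj : G → G → Prop
  /-- `IsStableNorm δ γ`: «the stable conjugacy class of `γ` is equal to `𝒩δ`» (`γ ∈ G(F)` is
  `G(F̄)`-conjugate to `Nδ`) [pp. 238–239] -/
  IsStableNorm : G → G → Prop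
  /-- `MeasCompat γ δ c`: «the measures used on `G_γ(F)`, `I_{δθ}(F)` correspond under the
  isomorphism» `g ↦ cgc⁻¹` [p. 241] -/
  MeasCompat : G → G → G → Prop
  /-- `Kappa δ`: the characters `κ` «on the group `H¹(F, I_{δθ})`» [p. 244] -/
  Kappa : G → Type u
  /-- `TOκ φ δ κ = O^κ_{δθ}(φ) = Σ_{δ′} ⟨inv(δ, δ′), κ⟩ O_{δ′θ}(φ)` [p. 244] -/
  TOκ : (G → ℂ) → (δ : G) → Kappa δ → ℂ
  /-- `Oκ φ δ γ c κ = O^κ_γ(φ) = Σ_{γ′} ⟨inv(γ, γ′), κ⟩ O_{γ′}(φ)`, `κ` viewed «as a character on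
  `H¹(F, T)`» through the canonical isomorphism `T = G_γ ≃ I_{δθ}` «given by `Int(c)⁻¹ ∘ p`» for
  `γ, δ, c` satisfying (A), (B) [p. 245] -/
  Oκ : (G → ℂ) → (δ : G) → G → G → Kappa δ → ℂ
  /-- `ML = M(L)` for «a Levi subgroup `M` of `G` over `𝔬`» [p. 247] -/
  ML : Subgroup G
  /-- `vM = v_M`, «a weight function `v_M` on `G(L)`» [p. 248] -/
  vM : G → ℝ
  /-- `WO φ γ = WO_γ(φ) = ∫_{G_γ(F)\G(F)} φ(g⁻¹γg) v_M(g) dg/dt` [p. 248] -/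
  WO : (G → ℂ) → G → ℂ
  /-- `WTO φ δ = WO_{δθ}(φ) = ∫_{I_{δθ}(F)\G(E)} φ(g⁻¹δθ(g)) v_M(g) dg_E/du` [p. 248] -/
  WTO : (G → ℂ) → G → ℂ

namespace UnitOrbitalData

variable {G : Type u} [Group G] {σ : MulAut G} {l j : ℕ} {KL : Subgroup G}
variable (D : UnitOrbitalData G σ l j KL)

/-- **The printed definition of `SO_γ`** (p. 238) as a law on the sockets: for semisimple `γ ∈ G(F)`
and any finite complete system `R` of representatives of the `G(F)`-conjugacy classes inside the
stable class of `γ`, `SO_γ(φ) = Σ_{γ′ ∈ R} e(G_{γ′}) O_{γ′}(φ)`.  Not asserted.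
[cite: Kottwitz1986BaseChangeUnits, Introduction p. 238] -/
def SOLaw : Prop :=
  ∀ φ : G → ℂ, ∀ γ ∈ ptsF σ, D.IsSemisimple γ → ∀ R : Finset G,
    (∀ γ' ∈ R, γ' ∈ ptsF σ ∧ D.IsStConj γ γ') →
    (∀ γ' ∈ R, ∀ γ'' ∈ R, IsConjUnder (ptsF σ) γ' γ'' → γ' = γ'') →
    (∀ γ'' ∈ ptsF σ, D.IsStConj γ γ'' → ∃ γ' ∈ R, IsConjUnder (ptsF σ) γ' γ'') →
      D.SO φ γ = ∑ γ' ∈ R, (D.sign γ' : ℤ) * D.O φ γ'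

/-- **The printed definition of `SO_{δθ}`** (pp. 238–239): for `δ ∈ G(E)` with `Nδ` semisimple and any
finite complete system `R` of representatives of the `θ`-conjugacy classes (under `G(E)`) inside the
stable twisted class of `δ`, `SO_{δθ}(φ) = Σ_{δ′ ∈ R} e(I_{δ′θ}) O_{δ′θ}(φ)`.  Not asserted.
[cite: Kottwitz1986BaseChangeUnits, Introduction pp. 238–239] -/
def STOLaw : Prop :=
  ∀ φ : G → ℂ, ∀ δ ∈ ptsE σ l, D.IsSemisimple (iterNorm (σ ^ j) l δ) → ∀ R : Finset G,
    (∀ δ' ∈ R, δ' ∈ ptsE σ l ∧ D.IsStTwConj δ δ') →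
    (∀ δ' ∈ R, ∀ δ'' ∈ R, IsTwConjUnder (ptsE σ l) (σ ^ j) δ' δ'' → δ' = δ'') →
    (∀ δ'' ∈ ptsE σ l, D.IsStTwConj δ δ'' → ∃ δ' ∈ R, IsTwConjUnder (ptsE σ l) (σ ^ j) δ' δ'') →
      D.STO φ δ = ∑ δ' ∈ R, (D.signTw δ' : ℤ) * D.TO φ δ'

/-- **«Since `O_γ(f) ≠ 0` (resp. `O_{δθ}(f_E) ≠ 0`) if and only if `X^γ` (resp. `X_E^{δθ}`) is
non-empty»** (p. 243; the displayed formulas of p. 240), as a law on the sockets.  Not asserted.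
[cite: Kottwitz1986BaseChangeUnits, §1 pp. 240, 243] -/
def NonvanishingLaw : Prop :=
  (∀ γ ∈ ptsF σ, D.O (unitF σ KL) γ ≠ 0 ↔ (fixX σ KL γ).Nonempty) ∧
    ∀ δ ∈ ptsE σ l, D.TO (unitE σ l KL) δ ≠ 0 ↔ (fixXE σ l j KL δ).Nonempty

/-- **«`f_E`, `f` have matching orbital integrals»** (p. 239) for a pair of test functions
`(φ_E, φ)`: «for every semisimple `γ ∈ G(F)` the stable orbital integral `SO_γ(f)` vanishes unless
the stable conjugacy class of `γ` is equal to `𝒩δ` for some `δ ∈ G(E)`, in which case it is given by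
`SO_γ(f) = SO_{δθ}(f_E)`» («Of course we are using compatible Haar measures on `G_γ(F)`, `I_{δθ}(F)`»).
[cite: Kottwitz1986BaseChangeUnits, Introduction p. 239] -/
def MatchingOrbitalIntegrals (φE φ : G → ℂ) : Prop :=
  ∀ γ ∈ ptsF σ, D.IsSemisimple γ →
    ((∀ δ ∈ ptsE σ l, ¬ D.IsStableNorm δ γ) → D.SO φ γ = 0) ∧
      ∀ δ ∈ ptsE σ l, D.IsStableNorm δ γ → D.SO φ γ = D.STO φE δ

/-! ## §2 The printed statements over the datum not carried by ★ MainResult: PROPOSITION 1, §3 -/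

-- THEOREM (p. 243), the sign equality (p. 243), COROLLARY + supplement (p. 244): see ★
-- `Literature.NumberTheory.Kottwitz1986BaseChangeUnits.MainResult.OrbitalDatum.{Theorem, signs_equal,
-- Corollary, Supplement}` (TK-t08, p848072); ED. 1's parallel rows were dropped in ED. 2.

/-- **PROPOSITION 1 (p. 245): `O^κ_{δθ}(f_E) = O^κ_γ(f)`**, for `δ ∈ G(E)` with `Nδ` regular
semisimple, `γ ∈ G(F)` with `γ ↔ δ` via `c` (so `T = G_γ` is a torus and `κ` is transported to
`H¹(F, T)`), and every character `κ` of `H¹(F, I_{δθ})`.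
[cite: Kottwitz1986BaseChangeUnits, §2 Proposition 1 p. 245] -/
def Kottwitz1986BaseChangeUnits_2_prop1 (a b : ℤ) : Prop :=
  KLConditions σ l KL → b * l - a * j = 1 →
    ∀ δ ∈ ptsE σ l, D.IsRegular (iterNorm (σ ^ j) l δ) →
      ∀ γ ∈ ptsF σ, ∀ c : G, SatisfiesAB σ l j a b γ δ c → D.MeasCompat γ δ c →
        ∀ κ : D.Kappa δ, D.TOκ (unitE σ l KL) δ κ = D.Oκ (unitF σ KL) δ γ c κ

/-- **The printed properties of `M` and `v_M`** (pp. 247–248) as a law on the sockets: `M` is «a Levi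
subgroup of `G` over `𝔬`», so `σ(M(L)) = M(L)`; `v_M` «is left invariant under `M(L)` and right
invariant under `K_L`».  Not asserted. [cite: Kottwitz1986BaseChangeUnits, §3 pp. 247–248] -/
def WeightLaw : Prop :=
  D.ML.map σ.toMonoidHom = D.ML ∧
    (∀ m ∈ D.ML, ∀ g : G, D.vM (m * g) = D.vM g) ∧ ∀ k ∈ KL, ∀ g : G, D.vM (g * k) = D.vM g

/-- **§3 PROPOSITION (p. 248): `WO_{δθ}(f_E) = WO_γ(f)`** — «Let `γ` be a regular semisimple element
of `M(F)`» … «Let `δ ∈ M(E)` and assume that `Nδ` is regular and semisimple» … «Suppose that our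
elements `γ ∈ M(F)` and `δ ∈ M(E)` are related by the correspondence `γ ↔ δ` for the group `M`, so that
there exists `c ∈ M(L)` such that `γ, δ, c` satisfy (A) and (B).»  Setting of §3 (p. 247): «We return
to the situation in the introduction, so that `G` is again unramified.  The hyperspecial point `x₀`
determines an extension of `G` to a connected reductive group over the valuation ring `𝔬` of `F`, and
we have `K_L = G(𝔬_L)`.  Let `M` be a Levi subgroup of `G` over `𝔬`.» — these hypotheses live in the
meaning of the sockets, not in the predicate.  (The row the Arthur (2013) audit reads as `Kt1Sec3` at
the `U(N)` datum.) [cite: Kottwitz1986BaseChangeUnits, §3 Proposition p. 248; §3 p. 247] -/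
def Kottwitz1986BaseChangeUnits_3_proposition (a b : ℤ) : Prop :=
  KLConditions σ l KL → b * l - a * j = 1 → D.WeightLaw →
    ∀ γ ∈ ptsF σ ⊓ D.ML, D.IsRegular γ →
      ∀ δ ∈ ptsE σ l ⊓ D.ML, D.IsRegular (iterNorm (σ ^ j) l δ) →
        ∀ c ∈ D.ML, SatisfiesAB σ l j a b γ δ c → D.MeasCompat γ δ c →
          D.WTO (unitE σ l KL) δ = D.WO (unitF σ KL) γ

/-- **«enough `γ, δ` are related by the correspondence `γ ↔ δ` for `M`»** (p. 249): «Suppose that `γ`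
is a regular semisimple element of `M(F)` such that `WO_γ(f) ≠ 0`. … there exists `δ ∈ M(E)` such that
`γ ↔ δ` in the group `M`.  Similarly, if `WO_{δθ}(f_E) ≠ 0`, then there exists `γ ∈ M(F)` such that
`γ ↔ δ` in the group `M`.» [cite: Kottwitz1986BaseChangeUnits, §3 p. 249] -/
def Kottwitz1986BaseChangeUnits_3_enough (a b : ℤ) : Prop :=
  KLConditions σ l KL → b * l - a * j = 1 → D.WeightLaw →
    (∀ γ ∈ ptsF σ ⊓ D.ML, D.IsRegular γ → D.WO (unitF σ KL) γ ≠ 0 →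
        ∃ δ ∈ ptsE σ l ⊓ D.ML, ∃ c ∈ D.ML, SatisfiesAB σ l j a b γ δ c) ∧
      ∀ δ ∈ ptsE σ l ⊓ D.ML, D.IsRegular (iterNorm (σ ^ j) l δ) → D.WTO (unitE σ l KL) δ ≠ 0 →
        ∃ γ ∈ ptsF σ ⊓ D.ML, ∃ c ∈ D.ML, SatisfiesAB σ l j a b γ δ c

end UnitOrbitalData

end Literature.NumberTheory.Kottwitz1986BaseChangeUnits.UnitOrbitalIntegrals
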